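import Summits.HodgeConjecture.HodgeConjecture.Theorems.GenericDivisibilityGenericDivisibilityBoundedLevelCleanFunnel
import HarnessLib

/-!
# Route GenericDivisibility — crux C2 `GenericDivisibilityBounded` (stmt-HodgeConjecture-18467):
# the crux from ONE clean prime per variety (the composition of line `finite-level-bootstrap`)

Line `finite-level-bootstrap`, lead c3 (cycle 5). Durable, importable, definition-free record of the
line's COMPOSITION (so far only in the crux workfile `Cruxes/GenericDivisibilityBounded/Lines/finite_level_bootstrap.lean`):

* `genericDivisibilityBounded_of_oneCleanPrime` — **heart ⇒ crux**: if every smooth projective complex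
  `2p`-fold, `p ≥ 2`, has a prime `ℓ` and a level `s ≥ 1` that is CLEAN ("`z| ≡ ℓ^s y` up to torsion
  on a non-empty Zariski open ⇒ `z ≡ ℓ w` modulo a generically-torsion class"; the registered stub
  `stub_finiteLevel`, verbatim), then `GenericDivisibilityBounded` holds — the `ℓ`-adic funnel
  `genericDivisibilityBounded_at_of_levelClean` (p150537: bootstrap up the tower, Krull on the finitely
  generated `H/GT`, bridge `GT ⊗ ℂ ⊆ N¹`) for `p ≥ 2` and the PROVED surface case
  `genericDivisibilityBounded_one` (p150537 ← p145990, p146835) for `p = 1`;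
* `stub_cruxOfOneCleanPrime` — the registered sub-goal form of the first (closed statement).

So the crux closes in one line the day the heart lands. (Companion file
`…GenericDivisibilityBoundedOffSmallChow`: the heart is only needed on `2p`-folds whose `0`-cycles have
`ℚ`-rank `≥ 2`, the Bloch–Srinivas sector being the theorem p157362.)

References: [ColliotTheleneVoisin2012] §3.1, §4.1; [HatcherAT2002] §3.1.
-/

-- `Summit.HodgeConjecture.HodgeConjecture.Theorems` is the mandated namespace (single-problem summit:
-- Problem = Summit), which `linter.dupNamespace` flags on every declaration; the lakefile turns the
-- linter off tree-wide (weak option), restated here so stand-alone elaboration is warning-free too.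
set_option linter.dupNamespace false

noncomputable section

namespace Summit.HodgeConjecture.HodgeConjecture.Theorems

open CategoryTheory AlgebraicGeometry
open Literature.AlgebraicGeometry.Motives Literature.AlgebraicGeometry.HodgeTheory
  Literature.AlgebraicTopology.SingularHomology
open Summit.HodgeConjecture.HodgeConjecture.Theses.GenericDivisibility

/-- **Heart ⇒ crux (line `finite-level-bootstrap`).** If every smooth projective complex `2p`-fold
with `p ≥ 2` admits a prime `ℓ` and a level `s ≥ 1` such that level `ℓ^s` is clean (hypothesis =
the registered stub `stub_finiteLevel` of stmt-HodgeConjecture-18467, verbatim), then the crux C2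
`GenericDivisibilityBounded` holds: for `p ≥ 2` by the `ℓ`-adic funnel
`genericDivisibilityBounded_at_of_levelClean` (bootstrap + Krull + `GT ⊗ ℂ ⊆ N¹`), for `p = 1` by the
proved surface case `genericDivisibilityBounded_one` (Colliot-Thélène–Voisin 2012 §4.1 in the tree's
vocabulary). [cite: ColliotTheleneVoisin2012, §3.1 and §4.1] [cite: HatcherAT2002, §3.1] -/
theorem genericDivisibilityBounded_of_oneCleanPrime
    (hHeart : ∀ ⦃p : ℕ⦄ ⦃X : SchemeOver ℂ⦄, 2 ≤ p → IsSmoothProjective (2 * p) X →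
      ∃ ℓ s : ℕ, ℓ.Prime ∧ 1 ≤ s ∧
        ∀ z : singularCohomology ℤ ℤ (ComplexPoints X) (2 * p),
          (∃ Z : Set X.left, IsClosed Z ∧ Z ≠ Set.univ ∧
            ∃ (y : singularCohomology ℤ ℤ (complexPointsCompl X Z) (2 * p)) (M : ℕ), 1 ≤ M ∧
              M • (singularCohomology.map ℤ ℤ
                (⟨Subtype.val, continuous_subtype_val⟩ : C(complexPointsCompl X Z, ComplexPoints X))
                (2 * p) z - ℓ ^ s • y) = 0) →
          ∃ w : singularCohomology ℤ ℤ (ComplexPoints X) (2 * p),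
            ∃ Z : Set X.left, IsClosed Z ∧ Z ≠ Set.univ ∧ ∃ N : ℕ, 1 ≤ N ∧
              N • singularCohomology.map ℤ ℤ
                (⟨Subtype.val, continuous_subtype_val⟩ : C(complexPointsCompl X Z, ComplexPoints X))
                (2 * p) (z - ℓ • w) = 0) :
    GenericDivisibilityBounded := by
  intro p X hp hX z hz
  rcases Nat.lt_or_ge p 2 with hp2 | hp2
  · obtain rfl : p = 1 := by omega
    exact genericDivisibilityBounded_one hX z hz
  · obtain ⟨ℓ, s, hℓ, hs, hclean⟩ := hHeart hp2 hX
    exact genericDivisibilityBounded_at_of_levelClean hX (2 * p) hℓ hs hclean z hz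

/-- **Registered sub-goal `stub_cruxOfOneCleanPrime` of stmt-HodgeConjecture-18467 (lead c3): the
composition of line `finite-level-bootstrap` as a closed statement** — the heart (registered stub
`stub_finiteLevel`, verbatim) implies the crux by name. [cite: ColliotTheleneVoisin2012, §3.1 and §4.1] -/
theorem stub_cruxOfOneCleanPrime : (∀ ⦃p : ℕ⦄ ⦃X : SchemeOver ℂ⦄, 2 ≤ p → IsSmoothProjective (2 * p) X → ∃ ℓ s : ℕ, ℓ.Prime ∧ 1 ≤ s ∧ ∀ z : singularCohomology ℤ ℤ (ComplexPoints X) (2 * p), (∃ Z : Set X.left, IsClosed Z ∧ Z ≠ Set.univ ∧ ∃ (y : singularCohomology ℤ ℤ (complexPointsCompl X Z) (2 * p)) (M : ℕ), 1 ≤ M ∧ M • (singularCohomology.map ℤ ℤ (⟨Subtype.val, continuous_subtype_val⟩ : C(complexPointsCompl X Z, ComplexPoints X)) (2 * p) z - ℓ ^ s • y) = 0) → ∃ w : singularCohomology ℤ ℤ (ComplexPoints X) (2 * p), ∃ Z : Set X.left, IsClosed Z ∧ Z ≠ Set.univ ∧ ∃ N : ℕ, 1 ≤ N ∧ N • singularCohomology.map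 ℤ ℤ (⟨Subtype.val, continuous_subtype_val⟩ : C(complexPointsCompl X Z, ComplexPoints X)) (2 * p) (z - ℓ • w) = 0) → Summit.HodgeConjecture.HodgeConjecture.Theses.GenericDivisibility.GenericDivisibilityBounded :=
  fun hHeart ↦ genericDivisibilityBounded_of_oneCleanPrime hHeart

end Summit.HodgeConjecture.HodgeConjecture.Theorems

end
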